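import Literature.Analysis.FunctionSpaces.TorusAnalyticComposition
import Literature.Analysis.Calculus.OrderedFinpartitionFactorialSum
import Mathlib.Analysis.Calculus.IteratedDeriv.FaaDiBruno
import Mathlib.Analysis.Calculus.FDeriv.CompCLM
import HarnessLib

/-!
# Proof of the Armstrong–Vicol composition estimate (App. A Prop. 7.6):
# `theorem Torus.ArmstrongVicol2025_composition_holds`

Analysis/FunctionSpaces proof file (theorems only; no definitions, no named facts). We discharge
the named fact `Torus.ArmstrongVicol2025_composition` of `TorusAnalyticComposition` by following the
printed proof (arXiv:2305.05048 p. 71) in the bookkeeping of Mathlib's Faà di Bruno formula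
(`iteratedFDeriv_comp` = `FormalMultilinearSeries.taylorComp`, a sum over `OrderedFinpartition n`):

* §1 coordinates: a continuous multilinear map on `(ℝ^d)^k` is bounded by its values on tuples of
  standard basis vectors times `Πᵢ ‖uᵢ‖_{ℓ¹}` (`norm_apply_le_of_basis_bound`), and the dictionary
  `Dᵏ(f∘proj)(v)(e_{J₁},…,e_{J_k}) = ∂_{J₁}⋯∂_{J_k} f (proj v)` (`iteratedFDeriv_lift_apply_single`);
* §2 the Faà di Bruno expansion of `Dⁿ((h∘proj) ∘ (id + D∘proj))` on basis vectors and the termwise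
  bound `C_h k!R_h^k(k+1)⁻² · Πᵢ d·C_g |cᵢ|! R_g^{|cᵢ|}(|cᵢ|+1)⁻²` (AV (7.6) first display);
* §3 Remark 7.5 (`(n+1)² ≤ (k+1)² Πᵢ(|cᵢ|+1)²`) and the re-summation Lemma 7.4 in total-order form
  (`OrderedFinpartition.sum_factorial_length_mul_pow_mul_prod_factorial_partSize`:
  `Σ_c k!x^kΠ|cᵢ|! = n!x(1+x)^{n−1}`), giving `‖∂^β(h∘g)‖ ≤ C_h R_gⁿ x(1+x)^{n−1} n!/(n+1)²`,
  `x = dC_gR_h`, whence `⟦h∘g⟧_{n,R_g(1+x)} ≤ C_h`.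

## References

* S. Armstrong, V. Vicol, *Anomalous diffusion by fractal homogenization*, Ann. PDE 11 (2025),
  arXiv:2305.05048, App. A Prop. 7.2, Lemma 7.4, Remark 7.5, Prop. 7.6 (p. 71). [`ArmstrongVicol2025`]
* L. Comtet, *Advanced Combinatorics* (Reidel 1974), Ch. III §3.4 (Faà di Bruno). [`Comtet1974`]
-/

noncomputable section

open Set Function Finset
open scoped Nat ContDiff

namespace Literature.Analysis.FunctionSpaces

namespace Torus

variable {d : Type*} [Fintype d] [DecidableEq d]
variable {F : Type*} [NormedAddCommGroup F] [NormedSpace ℝ F]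

/-! ## §1 Coordinates -/

/-- A vector of `ℝ^d` is the combination of the standard basis vectors with its coordinates. [folklore] -/
private theorem eq_sum_coord_smul_single (u : EuclideanSpace ℝ d) :
    u = ∑ j, u j • EuclideanSpace.single j (1 : ℝ) := by
  classical
  conv_lhs => rw [← (EuclideanSpace.basisFun d ℝ).sum_repr u]
  simp [EuclideanSpace.basisFun_apply]

/-- **Multilinear maps in coordinates**: if `‖M(e_{J₁}, …, e_{J_k})‖ ≤ B` for every tuple of standard
basis vectors, then `‖M(u₁, …, u_k)‖ ≤ B · Πᵢ Σⱼ |uᵢⱼ|`. [cite: ArmstrongVicol2025, App. A Prop. 7.2 (coordinate form)] -/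
theorem norm_apply_le_of_basis_bound {k : ℕ} (M : ContinuousMultilinearMap ℝ (fun _ : Fin k => EuclideanSpace ℝ d) F)
    {B : ℝ} (hB : ∀ J : Fin k → d, ‖M (fun i => EuclideanSpace.single (J i) (1 : ℝ))‖ ≤ B)
    (u : Fin k → EuclideanSpace ℝ d) :
    ‖M u‖ ≤ B * ∏ i, ∑ j, |u i j| := by
  classical
  have hu : u = fun i => ∑ j, u i j • EuclideanSpace.single j (1 : ℝ) :=
    funext fun i => eq_sum_coord_smul_single (u i)
  have hMu : M u = ∑ r : Fin k → d, (∏ i, u i (r i)) • M (fun i => EuclideanSpace.single (r i) (1 : ℝ)) := by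
    conv_lhs => rw [hu]
    rw [M.map_sum]
    exact Finset.sum_congr rfl fun r _ => M.map_smul_univ _ _
  rw [hMu, Fintype.prod_sum, Finset.mul_sum]
  refine (norm_sum_le _ _).trans (Finset.sum_le_sum fun r _ => ?_)
  rw [norm_smul, Real.norm_eq_abs, Finset.abs_prod, mul_comm]
  exact mul_le_mul_of_nonneg_right (hB r) (Finset.prod_nonneg fun i _ => abs_nonneg _)

/-- **Iterated Fréchet derivatives of the lift on basis vectors are word derivatives**:
`Dᵏ(φ∘proj)(v)(e_{J₀}, …, e_{J_{k-1}}) = ∂_{J₀} ⋯ ∂_{J_{k-1}} φ (proj v)` (the multi-index / tensor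
dictionary behind (A.1)). [cite: ArmstrongVicol2025, App. A (A.1) and Prop. 7.2 (∂^α as Dⁿ on coordinate vectors)] -/
theorem iteratedFDeriv_lift_apply_single {ψ : UnitAddTorus d → F} (hψ : IsSmooth ψ) :
    ∀ (k : ℕ) (J : Fin k → d) (v : EuclideanSpace ℝ d),
      iteratedFDeriv ℝ k (lift ψ) v (fun i => EuclideanSpace.single (J i) (1 : ℝ)) =
        iterPartialDeriv (List.ofFn J) ψ (proj v)
  | 0, J, v => by simp [lift_apply]
  | k + 1, J, v => by
    rw [iteratedFDeriv_succ_apply_left, List.ofFn_succ, iterPartialDeriv_cons]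
    have IH : (fun w => iteratedFDeriv ℝ k (lift ψ) w (fun i => EuclideanSpace.single (J (Fin.succ i)) (1 : ℝ))) =
        lift (iterPartialDeriv (List.ofFn fun i => J (Fin.succ i)) ψ) :=
      funext fun w => by rw [iteratedFDeriv_lift_apply_single hψ k _ w, lift_apply]
    have h1 : IsContDiff 1 (iterPartialDeriv (List.ofFn fun i => J (Fin.succ i)) ψ) :=
      (hψ.iterPartialDeriv _).isContDiff (by simp)
    rw [partialDeriv_eq_fderiv_apply h1, ← fderiv_lift, ← IH]
    have hd : DifferentiableAt ℝ (iteratedFDeriv ℝ k (lift ψ)) v :=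
      ((show ContDiff ℝ ∞ (lift ψ) from hψ).differentiable_iteratedFDeriv
        (by exact_mod_cast ENat.coe_lt_top k)).differentiableAt
    rw [fderiv_continuousMultilinear_apply_const_apply hd]
    rfl

/-! ## §2 The Faà di Bruno expansion on basis vectors -/

omit [DecidableEq d] in
/-- Mathlib's Faà di Bruno formula, evaluated: `Dⁿ(g∘f)(x)(m) = Σ_{c} D^{|c|}g(f x)(D^{|cᵢ|}f(x)(m∘embᵢ))ᵢ`.
[cite: ArmstrongVicol2025, App. A Prop. 7.2; Comtet1974, Ch. III §3.4] -/
theorem iteratedFDeriv_comp_apply_eq_sum {E' F' G' : Type*} [NormedAddCommGroup E'] [NormedSpace ℝ E']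
    [NormedAddCommGroup F'] [NormedSpace ℝ F'] [NormedAddCommGroup G'] [NormedSpace ℝ G']
    {g : F' → G'} {f : E' → F'} (hg : ContDiff ℝ ∞ g) (hf : ContDiff ℝ ∞ f) (x : E') (n : ℕ) (m : Fin n → E') :
    iteratedFDeriv ℝ n (g ∘ f) x m =
      ∑ c : OrderedFinpartition n, iteratedFDeriv ℝ c.length g (f x)
        (fun i => iteratedFDeriv ℝ (c.partSize i) f x (m ∘ c.emb i)) := by
  rw [iteratedFDeriv_comp (n := ∞) hg.contDiffAt hf.contDiffAt (by exact_mod_cast le_top)]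
  simp [FormalMultilinearSeries.taylorComp, ftaylorSeries, OrderedFinpartition.applyOrderedFinpartition_apply,
    Function.comp_def]

/-! ## §3 The inner map `G = id + D∘proj`, the termwise bounds, Remark 7.5 -/

omit [Fintype d] [DecidableEq d] in
/-- `lift (h(· + proj D ·)) = lift h ∘ (id + lift D)`. [cite: ArmstrongVicol2025, App. A Prop. 7.6 (torus rendering)] -/
private theorem lift_comp_eq (h : UnitAddTorus d → ℝ) (D : UnitAddTorus d → EuclideanSpace ℝ d) :
    lift (fun y => h (y + proj (D y))) = lift h ∘ fun v => v + lift D v := by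
  funext v
  rw [lift_apply, comp_apply, lift_apply, proj_add, lift_apply]

omit [DecidableEq d] in
/-- Linear maps have no derivatives of order `≥ 2`. [folklore] -/
private theorem iteratedFDeriv_id_eq_zero (j : ℕ) (w : EuclideanSpace ℝ d) :
    iteratedFDeriv ℝ (j + 2) (id : EuclideanSpace ℝ d → EuclideanSpace ℝ d) w = 0 := by
  rw [iteratedFDeriv_succ_eq_comp_right, comp_apply]
  have e : (fun y : EuclideanSpace ℝ d => _root_.fderiv ℝ (id : EuclideanSpace ℝ d → EuclideanSpace ℝ d) y) =
      fun _ => ContinuousLinearMap.id ℝ (EuclideanSpace ℝ d) := by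
    funext y; exact fderiv_id
  rw [e, iteratedFDeriv_const_of_ne (by omega), Pi.zero_apply, map_zero]

/-- First derivative of the inner map on a basis vector: `DG(v) e_j = e_j + ∂ⱼD(proj v)`.
[cite: ArmstrongVicol2025, App. A Prop. 7.6 (∂ⱼg = eⱼ + ∂ⱼD)] -/
private theorem iteratedFDeriv_one_inner {D : UnitAddTorus d → EuclideanSpace ℝ d} (hD : IsSmooth D)
    (K : Fin 1 → d) (v : EuclideanSpace ℝ d) :
    iteratedFDeriv ℝ 1 (fun v => v + lift D v) v (fun i => EuclideanSpace.single (K i) (1 : ℝ)) =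
      EuclideanSpace.single (K 0) (1 : ℝ) + partialDeriv (K 0) D (proj v) := by
  rw [iteratedFDeriv_one_apply]
  have hd : DifferentiableAt ℝ (lift D) v :=
    ((show ContDiff ℝ ∞ (lift D) from hD).differentiable (by simp)).differentiableAt
  have e : (fun v : EuclideanSpace ℝ d => v + lift D v) = id + lift D := rfl
  rw [e, _root_.fderiv_add differentiableAt_id hd, fderiv_id, partialDeriv_eq_fderiv_apply (hD.isContDiff (by simp)),
    ← fderiv_lift]
  rfl

omit [DecidableEq d] in
/-- Higher derivatives of the inner map are those of the displacement: `DˢG = Dˢ(D∘proj)`, `s ≥ 2`.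
[cite: ArmstrongVicol2025, App. A Prop. 7.6 (∂^α g = ∂^α D, |α| ≥ 2)] -/
private theorem iteratedFDeriv_inner_of_two_le {D : UnitAddTorus d → EuclideanSpace ℝ d} (hD : IsSmooth D)
    {s : ℕ} (hs : 2 ≤ s) (v : EuclideanSpace ℝ d) :
    iteratedFDeriv ℝ s (fun v => v + lift D v) v = iteratedFDeriv ℝ s (lift D) v := by
  obtain ⟨j, rfl⟩ : ∃ j, s = j + 2 := ⟨s - 2, by omega⟩
  have e : (fun v : EuclideanSpace ℝ d => v + lift D v) = id + lift D := rfl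
  rw [e, iteratedFDeriv_add_apply (contDiff_id.contDiffAt)
    (((show ContDiff ℝ ∞ (lift D) from hD).of_le (WithTop.coe_le_coe.mpr le_top)).contDiffAt),
    iteratedFDeriv_id_eq_zero, zero_add]

/-- **Block bound**: `‖DˢG(v)(e_{K₁},…,e_{K_s})‖ ≤ C_g s! R_gˢ/(s+1)²` for `1 ≤ s ≤ m`.
[cite: ArmstrongVicol2025, App. A Prop. 7.6 (hypothesis ⟦g⟧_{s,R_g} ≤ C_g)] -/
private theorem norm_iteratedFDeriv_inner_le {m : ℕ} {D : UnitAddTorus d → EuclideanSpace ℝ d} {Cg Rg : ℝ}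
    (hRg : 0 < Rg) (hD : IsSmooth D)
    (hg1 : 1 ≤ m → ∀ (j : d) (y : UnitAddTorus d), 4 / Rg * ‖EuclideanSpace.single j (1 : ℝ) + partialDeriv j D y‖ ≤ Cg)
    (hg2 : ∀ n, 2 ≤ n → n ≤ m → dnorm n Rg D ≤ Cg)
    {s : ℕ} (hs1 : 1 ≤ s) (hsm : s ≤ m) (K : Fin s → d) (v : EuclideanSpace ℝ d) :
    ‖iteratedFDeriv ℝ s (fun v => v + lift D v) v (fun i => EuclideanSpace.single (K i) (1 : ℝ))‖ ≤
      Cg * (((s)! : ℝ) * Rg ^ s) / ((s : ℝ) + 1) ^ 2 := by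
  rcases Nat.lt_or_ge s 2 with hs | hs
  · obtain rfl : s = 1 := by omega
    rw [iteratedFDeriv_one_inner hD K v]
    have h1 := hg1 hsm (K 0) (proj v)
    rw [mul_comm, ← le_div_iff₀ (by positivity)] at h1
    refine h1.trans (le_of_eq ?_)
    simp only [Nat.factorial_one, Nat.cast_one, one_mul, pow_one]
    field_simp
    norm_num
  · rw [iteratedFDeriv_inner_of_two_le hD hs, iteratedFDeriv_lift_apply_single hD s K v]
    exact norm_iterPartialDeriv_le_of_dnorm_le hD hRg (hg2 s hs hsm) (List.length_ofFn) (proj v)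

omit [DecidableEq d] in
/-- The part sizes add up to `n` (as in `OrderedFinpartitionFactorialSum`). [folklore] -/
private theorem sum_partSize'' {n : ℕ} (c : OrderedFinpartition n) : ∑ i, c.partSize i = n := by
  have h := Fintype.card_congr c.equivSigma
  simpa [Fintype.card_sigma] using h

omit [DecidableEq d] in
/-- **Remark 7.5** (total-order form): `(n+1)² ≤ (k+1)² Πᵢ (|cᵢ|+1)²` for an ordered finpartition of
`n ≥ 1` points with `k` parts (some part has `k|cᵢ| ≥ n`). [cite: ArmstrongVicol2025, App. A Remark 7.5] -/
private theorem remark75 {n : ℕ} (hn : 1 ≤ n) (c : OrderedFinpartition n) :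
    ((n : ℝ) + 1) ^ 2 ≤ ((c.length : ℝ) + 1) ^ 2 * ∏ i, ((c.partSize i : ℝ) + 1) ^ 2 := by
  have hk : 0 < c.length := c.length_pos (by omega)
  -- pigeonhole: a part of size ≥ n/k
  obtain ⟨i0, -, hi0⟩ : ∃ i ∈ (Finset.univ : Finset (Fin c.length)), n ≤ c.length * c.partSize i := by
    refine Finset.exists_le_of_sum_le ?_ (le_of_eq ?_)
    · exact ⟨⟨0, hk⟩, Finset.mem_univ _⟩
    · rw [Finset.sum_const, Finset.card_univ, Fintype.card_fin, smul_eq_mul, ← Finset.mul_sum, sum_partSize'']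
  have h1 : (n : ℝ) + 1 ≤ ((c.length : ℝ) + 1) * ((c.partSize i0 : ℝ) + 1) := by
    have h : (n : ℝ) ≤ (c.length : ℝ) * (c.partSize i0 : ℝ) := by exact_mod_cast hi0
    nlinarith [h, (Nat.cast_nonneg c.length : (0 : ℝ) ≤ c.length), (Nat.cast_nonneg (c.partSize i0) : (0 : ℝ) ≤ _)]
  have h2 : ((c.partSize i0 : ℝ) + 1) ^ 2 ≤ ∏ i, ((c.partSize i : ℝ) + 1) ^ 2 := by
    calc ((c.partSize i0 : ℝ) + 1) ^ 2 = ∏ i, (if i = i0 then ((c.partSize i : ℝ) + 1) ^ 2 else 1) := by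
          rw [Finset.prod_ite_eq']; simp
      _ ≤ ∏ i, ((c.partSize i : ℝ) + 1) ^ 2 := by
          refine Finset.prod_le_prod (fun i _ => ?_) (fun i _ => ?_)
          · split_ifs <;> positivity
          · split_ifs with h
            · exact le_rfl
            · nlinarith [(Nat.cast_nonneg (c.partSize i) : (0 : ℝ) ≤ _)]
  calc ((n : ℝ) + 1) ^ 2 ≤ (((c.length : ℝ) + 1) * ((c.partSize i0 : ℝ) + 1)) ^ 2 :=
        pow_le_pow_left₀ (by positivity) h1 2
    _ = ((c.length : ℝ) + 1) ^ 2 * ((c.partSize i0 : ℝ) + 1) ^ 2 := by ring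
    _ ≤ ((c.length : ℝ) + 1) ^ 2 * ∏ i, ((c.partSize i : ℝ) + 1) ^ 2 :=
        mul_le_mul_of_nonneg_left h2 (by positivity)

omit [DecidableEq d] in
/-- Algebra of the product of the block bounds. [folklore] -/
private theorem prod_block_bound_eq {N : ℕ} (c : OrderedFinpartition N) (a Cg Rg : ℝ) :
    ∏ i, (a * (Cg * (((c.partSize i)! : ℝ) * Rg ^ c.partSize i) / ((c.partSize i : ℝ) + 1) ^ 2)) =
      (a * Cg) ^ c.length * Rg ^ N * (∏ i, ((c.partSize i)! : ℝ)) / ∏ i, ((c.partSize i : ℝ) + 1) ^ 2 := by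
  simp_rw [mul_div_assoc']
  rw [Finset.prod_div_distrib]
  congr 1
  simp only [Finset.prod_mul_distrib, Finset.prod_const, Finset.card_univ, Fintype.card_fin,
    Finset.prod_pow_eq_pow_sum, sum_partSize'' c]
  ring

/-- **The heart of Prop. 7.6**: for a word `J` of length `n + 1 ≤ m`,
`|∂^J (h∘g)(proj v)| ≤ C_h R_g^{n+1} · x(1+x)ⁿ · (n+1)!/(n+2)²`, `x = d C_g R_h`.
[cite: ArmstrongVicol2025, App. A Prop. 7.6 (display (7.6))] -/
private theorem norm_iterPartialDeriv_comp_le {m : ℕ} {h : UnitAddTorus d → ℝ} {D : UnitAddTorus d → EuclideanSpace ℝ d}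
    {Ch Cg Rh Rg : ℝ} (hCh : 0 < Ch) (hCg : 0 < Cg) (hRh : 0 < Rh) (hRg : 0 < Rg)
    (hh' : IsSmooth h) (hD : IsSmooth D) (hh : ∀ n, n ≤ m → dnorm n Rh h ≤ Ch)
    (hg1 : 1 ≤ m → ∀ (j : d) (y : UnitAddTorus d), 4 / Rg * ‖EuclideanSpace.single j (1 : ℝ) + partialDeriv j D y‖ ≤ Cg)
    (hg2 : ∀ n, 2 ≤ n → n ≤ m → dnorm n Rg D ≤ Cg)
    {n : ℕ} (hnm : n + 1 ≤ m) (J : Fin (n + 1) → d) (v : EuclideanSpace ℝ d) :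
    ‖iterPartialDeriv (List.ofFn J) (fun y => h (y + proj (D y))) (proj v)‖ ≤
      Ch * Rg ^ (n + 1) / ((n : ℝ) + 1 + 1) ^ 2 *
        (((n + 1)! : ℝ) * ((Fintype.card d : ℝ) * Cg * Rh) * (1 + (Fintype.card d : ℝ) * Cg * Rh) ^ n) := by
  set x : ℝ := (Fintype.card d : ℝ) * Cg * Rh with hx
  have hG : ContDiff ℝ ∞ (fun v : EuclideanSpace ℝ d => v + lift D v) := contDiff_id.add hD
  have hf : IsSmooth (fun y => h (y + proj (D y))) := by
    show ContDiff ℝ ∞ (lift fun y => h (y + proj (D y)))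
    rw [lift_comp_eq]
    exact (show ContDiff ℝ ∞ (lift h) from hh').comp hG
  -- Step 1: the word derivative is the Faà di Bruno sum
  rw [← iteratedFDeriv_lift_apply_single hf (n + 1) J v, lift_comp_eq, iteratedFDeriv_comp_apply_eq_sum hh' hG v]
  -- Step 2: termwise bound
  have hM : ∀ (c : OrderedFinpartition (n + 1)) (J' : Fin c.length → d),
      ‖iteratedFDeriv ℝ c.length (lift h) (v + lift D v) (fun i => EuclideanSpace.single (J' i) (1 : ℝ))‖ ≤
        Ch * (((c.length)! : ℝ) * Rh ^ c.length) / ((c.length : ℝ) + 1) ^ 2 := by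
    intro c J'
    rw [iteratedFDeriv_lift_apply_single hh' c.length J' _]
    exact norm_iterPartialDeriv_le_of_dnorm_le hh' hRh (hh c.length (c.length_le.trans hnm)) (List.length_ofFn) _
  have hterm : ∀ c : OrderedFinpartition (n + 1),
      ‖iteratedFDeriv ℝ c.length (lift h) (v + lift D v)
          (fun i => iteratedFDeriv ℝ (c.partSize i) (fun v => v + lift D v) v
            ((fun t => EuclideanSpace.single (J t) (1 : ℝ)) ∘ c.emb i))‖ ≤
        Ch * (((c.length)! : ℝ) * Rh ^ c.length) / ((c.length : ℝ) + 1) ^ 2 *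
          ∏ i, ((Fintype.card d : ℝ) * (Cg * (((c.partSize i)! : ℝ) * Rg ^ c.partSize i) / ((c.partSize i : ℝ) + 1) ^ 2)) := by
    intro c
    refine (norm_apply_le_of_basis_bound _ (hM c) _).trans ?_
    refine mul_le_mul_of_nonneg_left ?_ (by positivity)
    refine Finset.prod_le_prod (fun i _ => Finset.sum_nonneg fun j _ => abs_nonneg _) fun i _ => ?_
    have hu := norm_iteratedFDeriv_inner_le hRg hD hg1 hg2 (c.partSize_pos i) ((c.partSize_le i).trans hnm)
      (fun t => J (c.emb i t)) v
    calc ∑ j, |(iteratedFDeriv ℝ (c.partSize i) (fun v => v + lift D v) v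
              ((fun t => EuclideanSpace.single (J t) (1 : ℝ)) ∘ c.emb i)) j|
        ≤ ∑ _j : d, ‖iteratedFDeriv ℝ (c.partSize i) (fun v => v + lift D v) v
              ((fun t => EuclideanSpace.single (J t) (1 : ℝ)) ∘ c.emb i)‖ :=
          Finset.sum_le_sum fun j _ => by rw [← Real.norm_eq_abs]; exact PiLp.norm_apply_le _ j
      _ = (Fintype.card d : ℝ) * ‖iteratedFDeriv ℝ (c.partSize i) (fun v => v + lift D v) v
              ((fun t => EuclideanSpace.single (J t) (1 : ℝ)) ∘ c.emb i)‖ := by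
          rw [Finset.sum_const, Finset.card_univ, nsmul_eq_mul]
      _ ≤ (Fintype.card d : ℝ) * (Cg * (((c.partSize i)! : ℝ) * Rg ^ c.partSize i) / ((c.partSize i : ℝ) + 1) ^ 2) :=
          mul_le_mul_of_nonneg_left hu (Nat.cast_nonneg _)
  -- Step 3: sum the termwise bounds (Remark 7.5 + Lemma 7.4)
  refine (norm_sum_le _ _).trans ((Finset.sum_le_sum fun c _ => hterm c).trans ?_)
  have hkey : ∀ c : OrderedFinpartition (n + 1),
      Ch * (((c.length)! : ℝ) * Rh ^ c.length) / ((c.length : ℝ) + 1) ^ 2 *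
          ∏ i, ((Fintype.card d : ℝ) * (Cg * (((c.partSize i)! : ℝ) * Rg ^ c.partSize i) / ((c.partSize i : ℝ) + 1) ^ 2))
        ≤ Ch * Rg ^ (n + 1) / ((n : ℝ) + 1 + 1) ^ 2 *
          (((c.length)! : ℝ) * x ^ c.length * ∏ i, ((c.partSize i)! : ℝ)) := by
    intro c
    rw [prod_block_bound_eq]
    have hP : 0 < ∏ i, ((c.partSize i : ℝ) + 1) ^ 2 := Finset.prod_pos fun i _ => by positivity
    have h75 := remark75 (by omega) c
    -- rewrite both sides as (common nonnegative factor) × (weight)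
    have e1 : Ch * (((c.length)! : ℝ) * Rh ^ c.length) / ((c.length : ℝ) + 1) ^ 2 *
        (((Fintype.card d : ℝ) * Cg) ^ c.length * Rg ^ (n + 1) * (∏ i, ((c.partSize i)! : ℝ)) /
          ∏ i, ((c.partSize i : ℝ) + 1) ^ 2) =
        Ch * Rg ^ (n + 1) * (((c.length)! : ℝ) * x ^ c.length * ∏ i, ((c.partSize i)! : ℝ)) *
          (1 / (((c.length : ℝ) + 1) ^ 2 * ∏ i, ((c.partSize i : ℝ) + 1) ^ 2)) := by
      rw [hx, mul_pow, mul_pow]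
      field_simp
      ring
    have e2 : Ch * Rg ^ (n + 1) / ((n : ℝ) + 1 + 1) ^ 2 * (((c.length)! : ℝ) * x ^ c.length * ∏ i, ((c.partSize i)! : ℝ)) =
        Ch * Rg ^ (n + 1) * (((c.length)! : ℝ) * x ^ c.length * ∏ i, ((c.partSize i)! : ℝ)) *
          (1 / ((n : ℝ) + 1 + 1) ^ 2) := by
      field_simp
    rw [e1, e2]
    refine mul_le_mul_of_nonneg_left ?_ (by positivity)
    rw [one_div_le_one_div (by positivity) (by positivity)]
    have : ((n : ℝ) + 1 + 1) = (((n + 1 : ℕ) : ℝ) + 1) := by push_cast; ring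
    rw [this]
    exact h75
  refine (Finset.sum_le_sum fun c _ => hkey c).trans (le_of_eq ?_)
  rw [← Finset.mul_sum, OrderedFinpartition.sum_factorial_length_mul_pow_mul_prod_factorial_partSize n x]

/-! ## §4 The discharge -/

/-- **Armstrong–Vicol, App. A Prop. 7.6 (composition estimate) — proved.** With
`⟦h⟧_{n,R_h} ≤ C_h` (`0 ≤ n ≤ m`) and `⟦g⟧_{n,R_g} ≤ C_g` (`1 ≤ n ≤ m`, `g = id + D`),
`⟦h∘g⟧_{n,R} ≤ C_h` for all `0 ≤ n ≤ m`, `R = R_g(1 + dC_gR_h)`.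
[cite: ArmstrongVicol2025, App. A Prop. 7.6 (arXiv §7 p. 71)] -/
theorem ArmstrongVicol2025_composition_holds :
    ∀ (d : Type*) [Fintype d] [DecidableEq d], ArmstrongVicol2025_composition d := by
  intro d _ _ m h D Ch Cg Rh Rg hCh hCg hRh hRg hh' hD hh hg1 hg2 n hn
  set x : ℝ := (Fintype.card d : ℝ) * Cg * Rh with hx
  have hx0 : 0 ≤ x := by positivity
  have hR : 0 < Rg * (1 + (Fintype.card d : ℝ) * Cg * Rh) := by positivity
  refine dnorm_le_of_forall_norm_iterPartialDeriv_le hR hCh.le fun l hl y => ?_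
  obtain ⟨v, rfl⟩ := proj_surjective y
  rcases Nat.eq_zero_or_pos n with hn0 | hnpos
  · -- order zero: `|h(g(y))| ≤ ⟦h⟧_{0,R_h} ≤ C_h`
    subst hn0
    obtain rfl : l = [] := List.eq_nil_of_length_eq_zero hl
    have h0 := norm_iterPartialDeriv_le_of_dnorm_le hh' hRh (hh 0 hn) (l := []) rfl (proj v + proj (D (proj v)))
    simpa using h0
  · -- order `n = n' + 1`: the Faà di Bruno estimate
    obtain ⟨n', rfl⟩ : ∃ n', n = n' + 1 := ⟨n - 1, by omega⟩
    -- reparametrize the word by `Fin (n'+1)`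
    set J : Fin (n' + 1) → d := fun i => l.get (Fin.cast hl.symm i) with hJ
    have e : List.ofFn J = l := by
      refine List.ext_get (by rw [List.length_ofFn, hl]) fun i h1 h2 => ?_
      rw [List.get_ofFn]
      rfl
    rw [← e]
    refine (norm_iterPartialDeriv_comp_le hCh hCg hRh hRg hh' hD hh hg1 hg2 hn J v).trans ?_
    rw [← hx]
    -- `x(1+x)^{n'} ≤ (1+x)^{n'+1}`
    have h1 : x * (1 + x) ^ n' ≤ (1 + x) ^ (n' + 1) := by
      rw [pow_succ']
      exact mul_le_mul_of_nonneg_right (by linarith) (by positivity)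
    have e2 : Rg * (1 + (Fintype.card d : ℝ) * Cg * Rh) = Rg * (1 + x) := by rw [hx]
    rw [e2, mul_pow]
    have e3 : ((n' + 1 : ℕ) : ℝ) + 1 = (n' : ℝ) + 1 + 1 := by push_cast; ring
    rw [e3]
    have hA : 0 ≤ Ch * Rg ^ (n' + 1) / ((n' : ℝ) + 1 + 1) ^ 2 * (((n' + 1)! : ℝ)) := by positivity
    calc Ch * Rg ^ (n' + 1) / ((n' : ℝ) + 1 + 1) ^ 2 * (((n' + 1)! : ℝ) * x * (1 + x) ^ n')
        = Ch * Rg ^ (n' + 1) / ((n' : ℝ) + 1 + 1) ^ 2 * ((n' + 1)! : ℝ) * (x * (1 + x) ^ n') := by ring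
      _ ≤ Ch * Rg ^ (n' + 1) / ((n' : ℝ) + 1 + 1) ^ 2 * ((n' + 1)! : ℝ) * (1 + x) ^ (n' + 1) :=
          mul_le_mul_of_nonneg_left h1 hA
      _ = Ch * (((n' + 1)! : ℝ) * (Rg ^ (n' + 1) * (1 + x) ^ (n' + 1))) / ((n' : ℝ) + 1 + 1) ^ 2 := by ring

end Torus

end Literature.Analysis.FunctionSpaces

end
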